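import Summits.QuantumFields.BalabanUV.Beta.GAN24.PerfectStepFibre
import Summits.QuantumFields.BalabanUV.Beta.FP.ConvergenceJMMultiplier

/-!
# `BalabanUV.Beta.GAN24.PerfectResolventFibre` — binder row G-an2-4 ∕ (CONV-C), lineage gan24-p3 (part P3, Woodbury ∕ fibre layer):
# **THE (j, m)-RESOLVENTS AT THE FIBRE LEVEL, AND ROAD FP's X1m-K LOCATED AS ONE FINITE-MATRIX REAL-ZONE ESTIMATE** — the unit-rescaled (j, m)-resolvent
# `unitK (sf j) (sm j) (FP.PerfectObjects.KTot (Lc^(j+m)) (Lc^j))` is the lattice kernel (offset `0`) of the explicit finite phase-dressed fibre function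
# `kFibM … m j := kFibW (Lc^(j+m)) (Lc^j) (sf j) (sm j)` on the `j`-FREE support `LegOn (Lc^m)`; a `j`-geometric real-zone rate `RealRateKM d Lc m c θ` (θ < 1) of these
# finite sums — the EXACT `m`-analogue of road P1's row L11 shape (I2′) `ConvCKOfShapes.RealRateK` (`RealRateKM d Lc 1 = RealRateK d Lc`, by `Iff.rfl`) — IMPLIES X1m-K
# (the entrywise convergence of the (j, m)-family, hypothesis `hconv` of `FP.StationarityK` ∕ `FP.SymmetryK` ∕ `FP.PerfectRebase` ∕ `FP.PerfectSymbolKBloch`) AND names the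
# limit: `KPerf Lc (sfStep Lc) (smStep d Lc) m x′ y′ a b = [LegOn (Lc^m) a x′ ∧ LegOn (Lc^m) b y′] · Re latticeKernel (kFibMLim … m a x′ b y′) 0`

NOT IN PRINT; OUR PROOF (bookkeeping over tree theorems BY NAME).  HONEST FRAMING (cell contract, verbatim): «discharging `BetaPertH` makes Bałaban's UV
stability UNCONDITIONAL — a real constructive-QFT result; it is NOT the continuum limit and NOT the Clay problem.»  HONEST DEPENDENCY (verbatim): «continuum
YM on T⁴ ⇐ BetaPertH ∧ nine spine estimates (0/9 proved); BetaPertH ⇐ (D1) ∧ (D4) ∧ CAP+tail; G-an2-4 gates asym, D1 and NE2/3/4.»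

WHY.  Road FP's perfect `m`-fold resolvents `KPerf … m` (binder D1) are typed as entrywise constructed limits of the (j, m)-family; their CONVERGENCE for `m ≥ 2`
(X1m-K ∕ X1m-der of `HOME/b2b-balaban-beta-d1-p3/LEAVES-FP.md`) is the located open input of several landed FP leaves, proved so far only along `j ∈ mℕ`
(`FP.PerfectRebase`) and for the mm quarter (`FP.ConvergenceJMMultiplier`).  Road P1 closed the `m = 1` case by reducing it (`CombesThomasFibreStep.supRateK_of_kFib`)
to an ENTRYWISE REAL-ZONE RATE of explicit finite matrices and proving that rate (`FibreRate.realRateK`).  THIS FILE performs the same reduction for EVERY `m`: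
`CombesThomasFibreStep.unitK_dec_KInv_eq` (general blocking `N`, decimation `M`) at `N := Lc^(j+m)`, `M := Lc^j`, the `j`-free support
`ConvergenceJMMultiplier.proj_pow_add_smul_eq_zero_iff`, and the Cauchy ∕ dominated-convergence bookkeeping of `GAN24.PerfectStepFibre`.
WHAT REMAINS for X1m-K is then ONE typed finite-matrix statement, `RealRateKM d Lc m c θ` with `θ < 1` — for road P1's alias machinery at relative blocking `Lc^m`.

CONTENT (all [our object] ∕ [folklore]; general `d`, `Lc ≥ 1`, units `sf sm : ℕ → ℝ` where free, adopted units `(sfStep Lc, smStep d Lc)` in the shapes):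
* §1 `kFibM Lc sf sm m j a x′ b y′ := kFibW (Lc^(j+m)) (Lc^j) (sf j) (sm j) a x′ b y′` (`kFibM … 1 j = kFib … j`, `rfl`); `legOn_pow_add_iff`; **`unitK_KTot_eq`**:
  `unitK (sf j) (sm j) (KTot (Lc^(j+m)) (Lc^j)) x′ y′ a b = [LegOn (Lc^m) a x′ ∧ LegOn (Lc^m) b y′] · Re latticeKernel (kFibM … m j a x′ b y′) 0`.
* §2 [shape] `RealRateKM d Lc m c θ` (a binder shape asserted of nothing); `realRateKM_one_iff : RealRateKM d Lc 1 c θ ↔ RealRateK d Lc c θ`;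
  `realRateKM_one_holds` (`d = 3`, `2 ≤ Lc`: road P1's `FibreRate.realRateK`, constants `cFF+cMF+cMF+cmm`, `θ = Lc⁻²`).
* §3 under `RealRateKM d Lc m c θ`, `0 ≤ θ < 1`: `abs_KTot_succ_sub_le` (the one-step SUP-NORM rate `c·θ^j` of the (j, m)-family), **`exists_tendsto_KTot_of_realRateKM`**
  (= X1m-K, LITERALLY the `hconv` hypothesis of `FP.PerfectRebase.KPerf_eq_KPerf_pow_base_of_exists_tendsto`), `abs_KTot_sub_KPerf_le` (`≤ c·θ^j/(1−θ)` to `KPerf … m`).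
* §4 the limit multiplier `kFibMLim … m a x′ b y′ := limUnder_j kFibM … m j a x′ b y′` (`kFibMLim … 1 = PerfectStepFibre.kFibLim …`, `rfl`); real-zone convergence and tail;
  `tendsto_latticeKernel_kFibM` (dominated convergence; majorant `‖kFibM … m 0 (p)‖ + 2c/(1−θ)` — NO strip bound needed); **`KPerf_eq_fibre_of_realRateKM`**:
  `KPerf Lc (sfStep Lc) (smStep d Lc) m x′ y′ a b = [LegOn (Lc^m) …] · Re latticeKernel (kFibMLim … m a x′ b y′) 0`.
HONEST: `RealRateKM d Lc m c θ` for `m ≥ 2` is NOT proved here or anywhere in the tree — it is the fibre-level form of road FP's open X1m-K; this file is a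
REDUCTION (kernel-checked), not a discharge; 0 wall binders instantiated; NOT «X1m closed», NOT «N0b-K closed», NEVER «G-an2-4 closed», NOT BetaPertH, NOT continuum, NOT Clay.

ABSOLUTE RULE (cell, verbatim): «No internally-minted statement may enter as a cited fact. Every hypothesis is either kernel-proved in this package or a
verbatim quotation of a PUBLISHED theorem with page reference.»  Nothing is cited; the one `def … : Prop` (`RealRateKM`) is a binder SHAPE asserted of nothing
(consumed as a hypothesis, instantiated at `m = 1` by a tree theorem); two data defs (`kFibM`, `kFibMLim`); every input is a tree theorem imported BY NAME.
-/

namespace Summit.QuantumFields.BalabanUV.Beta.GAN24.PerfectResolventFibre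

open Filter Topology MeasureTheory Complex
open Literature.Probability.LatticeModels (Torus.proj)
open Literature.MathematicalPhysics.QuantumFieldTheory
open Literature.MathematicalPhysics.QuantumFieldTheory.Balaban1983to89
open Literature.MathematicalPhysics.QuantumFieldTheory.Balaban1983to89.Beta
open B4Strip (ofRealVec)
open B4ContourShift (BZ integrand fourierBox latticeKernel norm_cexp_phase)
open B4Green242Bridge (latticeKernel_sub)
open ExpKernelCalculus (MKer)
open OneStepResolventKernel (Fib KInv)
open OneStepKernelFamily (dec)
open HessKerDressedLimit (limMKerOf limMKerOf_apply)
open Summit.QuantumFields.BalabanUV.Beta.HessKerDressedUnits (unitK)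
open Summit.QuantumFields.BalabanUV.Beta.GAN24.CombesThomas (sfStep smStep)
open Summit.QuantumFields.BalabanUV.Beta.GAN24.CombesThomasFibre (LegOn abs_re_latticeKernel_le_of_norm_le)
open Summit.QuantumFields.BalabanUV.Beta.GAN24.CombesThomasFibreStep (kFibW kFib unitK_dec_KInv_eq integrableOn_kFibW integrableOn_norm_of_integrand_zero)
open Summit.QuantumFields.BalabanUV.Beta.GAN24.ConvCKOfShapes (RealRateK)
open Summit.QuantumFields.BalabanUV.Beta.GAN24.FibreRate (cFF cMF realRateK)
open Summit.QuantumFields.BalabanUV.Beta.GAN24.FibreRateOfLegs (cmm)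
open Summit.QuantumFields.BalabanUV.Beta.FP.PerfectObjects (KTot KTot_def)
open Summit.QuantumFields.BalabanUV.Beta.FP.PerfectObjectsT (KPerf)
open Summit.QuantumFields.BalabanUV.Beta.FP.ConvergenceJMMultiplier (proj_pow_add_smul_eq_zero_iff)
open Summit.QuantumFields.BalabanUV.Beta.GAN24.PerfectStepFibre (kFibLim volume_BZ_lt_top theta_nonneg_lt_one)

noncomputable section

/-! ## §1 The (j, m)-resolvents at the fibre level -/

section Fibre

variable {d : ℕ} {Lc : ℕ} [NeZero Lc]

/-- [our object] **THE FIBRE FUNCTION OF THE UNIT-RESCALED (j, m)-RESOLVENT**: road P1's general phase-dressed leg sum `kFibW` at blocking `N := Lc^(j+m)`,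
decimation `M := Lc^j`, units `(sf j, sm j)`.  An explicit finite sum of inverse-fibre entries — no estimate. -/
def kFibM (Lc : ℕ) [NeZero Lc] (sf sm : ℕ → ℝ) (m j : ℕ) (a : Fib d) (x' : Fin (d + 1) → ℤ) (b : Fib d) (y' : Fin (d + 1) → ℤ) :
    (Fin (d + 1) → ℂ) → ℂ :=
  kFibW (Lc ^ (j + m)) (Lc ^ j) (sf j) (sm j) a x' b y'

/-- [folklore] `m = 1`: the (j, 1)-fibre function IS road P1's step fibre function `kFib … j`. -/
theorem kFibM_one (sf sm : ℕ → ℝ) (j : ℕ) (a : Fib d) (x' : Fin (d + 1) → ℤ) (b : Fib d) (y' : Fin (d + 1) → ℤ) :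
    kFibM Lc sf sm 1 j a x' b y' = kFib Lc sf sm j a x' b y' := rfl

/-- [folklore] THE SUPPORT CONDITION IS `j`-FREE: a leg of the blocking-`Lc^(j+m)` system at the decimated point `Lc^j • x′` is on iff `x′` is on for blocking `Lc^m`
(field legs: always; multiplier legs: `ConvergenceJMMultiplier.proj_pow_add_smul_eq_zero_iff`). -/
theorem legOn_pow_add_iff (j m : ℕ) (a : Fib d) (x' : Fin (d + 1) → ℤ) :
    LegOn (Lc ^ (j + m)) a (((Lc ^ j : ℕ) : ℤ) • x') ↔ LegOn (Lc ^ m) a x' := by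
  cases a with
  | inl κ => exact Iff.rfl
  | inr κ => exact proj_pow_add_smul_eq_zero_iff j m x'

/-- [our object] **THE UNIT-RESCALED (j, m)-RESOLVENT AT THE FIBRE LEVEL**:
`unitK (sf j) (sm j) (KTot (Lc^(j+m)) (Lc^j)) x′ y′ a b = [LegOn (Lc^m) a x′ ∧ LegOn (Lc^m) b y′] · Re latticeKernel (kFibM … m j a x′ b y′) 0`
(`KTot n M = dec M (KInv n)` by `rfl`; `CombesThomasFibreStep.unitK_dec_KInv_eq`; §1 support). -/
theorem unitK_KTot_eq (sf sm : ℕ → ℝ) (m j : ℕ) (x' y' : Fin (d + 1) → ℤ) (a b : Fib d) :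
    unitK (sf j) (sm j) (KTot (d := d) (Lc ^ (j + m)) (Lc ^ j)) x' y' a b =
      if LegOn (Lc ^ m) a x' ∧ LegOn (Lc ^ m) b y' then (latticeKernel (kFibM Lc sf sm m j a x' b y') 0).re else 0 := by
  rw [KTot_def, unitK_dec_KInv_eq]
  simp only [legOn_pow_add_iff]
  rfl

/-- [folklore] `kFibM` has an integrable lattice-kernel integrand on the real zone, every offset. -/
theorem integrableOn_kFibM (sf sm : ℕ → ℝ) (m j : ℕ) (a : Fib d) (x' : Fin (d + 1) → ℤ) (b : Fib d) (y' : Fin (d + 1) → ℤ)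
    (x : Fin (d + 1) → ℤ) : IntegrableOn (integrand (kFibM Lc sf sm m j a x' b y') x) (BZ (d + 1)) :=
  integrableOn_kFibW _ _ _ _ _ _ _ x

end Fibre

/-! ## §2 The shape `RealRateKM` — the `m`-analogue of road P1's (I2′) -/

section Shape

variable {d : ℕ} {Lc : ℕ} [NeZero Lc]

/-- [shape] **X1m-K AT THE FIBRE LEVEL**: a `j`-GEOMETRIC REAL-ZONE RATE `‖kFibM … m (j+1) (p) − kFibM … m j (p)‖ ≤ c·θ^j` on the Brillouin zone, in the adopted
units, for every leg pair and base points — the exact `m`-analogue of `ConvCKOfShapes.RealRateK` (road P1 row L11).  A predicate, asserted of NOTHING;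
for `m ≥ 2` it is road FP's located open input X1m-K in finite-matrix form. -/
def RealRateKM (d Lc : ℕ) [NeZero Lc] (m : ℕ) (c θ : ℝ) : Prop :=
  ∀ (j : ℕ) (x' y' : Fin (d + 1) → ℤ) (a b : Fib d), ∀ p ∈ BZ (d + 1),
    ‖kFibM Lc (sfStep Lc) (smStep d Lc) m (j + 1) a x' b y' (ofRealVec p) - kFibM Lc (sfStep Lc) (smStep d Lc) m j a x' b y' (ofRealVec p)‖
      ≤ c * θ ^ j

/-- [folklore] `m = 1`: the shape IS road P1's (I2′). -/
theorem realRateKM_one_iff (c θ : ℝ) : RealRateKM d Lc 1 c θ ↔ RealRateK d Lc c θ := Iff.rfl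

/-- [our object] `m = 1`, `d = 3`, `2 ≤ Lc`: the shape HOLDS — road P1's `FibreRate.realRateK` (constants `cFF+cMF+cMF+cmm`, ratio `Lc⁻²`) BY NAME. -/
theorem realRateKM_one_holds {Lc : ℕ} [NeZero Lc] (hLc : 2 ≤ Lc) :
    RealRateKM 3 Lc 1 (cFF Lc + cMF Lc + cMF Lc + cmm Lc) (((Lc : ℝ) ^ 2)⁻¹) :=
  (realRateKM_one_iff _ _).2 (realRateK hLc)

/-- [folklore] The shape forces `0 ≤ c` (`j = 0`, `p = 0`). -/
theorem c_nonneg_of_realRateKM {m : ℕ} {c θ : ℝ} (hB : RealRateKM d Lc m c θ) : 0 ≤ c := by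
  have h := hB 0 0 0 (Sum.inr 0) (Sum.inr 0) (fun _ => 0) FibreArrowBZ.zero_mem_BZ
  rw [pow_zero, mul_one] at h
  exact (norm_nonneg _).trans h

end Shape

/-! ## §3 Under the shape: the sup-norm rate of the (j, m)-family and X1m-K -/

section Rate

variable {d : ℕ} {Lc : ℕ} [NeZero Lc] {m : ℕ} {c θ : ℝ}

/-- [our object] **THE ONE-STEP SUP-NORM RATE OF THE (j, m)-FAMILY** from the fibre rate: entrywise
`|unitK_{j+1} (KTot (Lc^(j+1+m)) (Lc^(j+1))) − unitK_j (KTot (Lc^(j+m)) (Lc^j))| ≤ c·θ^j` (`Re ∫ = ∫ Re`-free: the modulus of the real part of a lattice kernel is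
at most the sup of the multiplier — `CombesThomasFibre.abs_re_latticeKernel_le_of_norm_le`). -/
theorem abs_KTot_succ_sub_le (hθ0 : 0 ≤ θ) (hB : RealRateKM d Lc m c θ) (j : ℕ) (x' y' : Fin (d + 1) → ℤ) (a b : Fib d) :
    |unitK (sfStep Lc (j + 1)) (smStep d Lc (j + 1)) (KTot (d := d) (Lc ^ (j + 1 + m)) (Lc ^ (j + 1))) x' y' a b -
        unitK (sfStep Lc j) (smStep d Lc j) (KTot (d := d) (Lc ^ (j + m)) (Lc ^ j)) x' y' a b| ≤ c * θ ^ j := by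
  rw [unitK_KTot_eq, unitK_KTot_eq]
  by_cases h : LegOn (Lc ^ m) a x' ∧ LegOn (Lc ^ m) b y'
  · rw [if_pos h, if_pos h, ← Complex.sub_re,
      ← latticeKernel_sub 0 (integrableOn_kFibM _ _ m (j + 1) a x' b y' 0) (integrableOn_kFibM _ _ m j a x' b y' 0)]
    refine abs_re_latticeKernel_le_of_norm_le _ 0 ?_ (hB j x' y' a b)
    refine integrableOn_norm_of_integrand_zero
      (G := fun P => kFibM Lc (sfStep Lc) (smStep d Lc) m (j + 1) a x' b y' P - kFibM Lc (sfStep Lc) (smStep d Lc) m j a x' b y' P) ?_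
    have e : integrand (fun P => kFibM Lc (sfStep Lc) (smStep d Lc) m (j + 1) a x' b y' P -
        kFibM Lc (sfStep Lc) (smStep d Lc) m j a x' b y' P) 0 =
        fun p => integrand (kFibM Lc (sfStep Lc) (smStep d Lc) m (j + 1) a x' b y') 0 p -
          integrand (kFibM Lc (sfStep Lc) (smStep d Lc) m j a x' b y') 0 p := by
      funext p; unfold integrand; ring
    rw [e]
    exact (integrableOn_kFibM _ _ m (j + 1) a x' b y' 0).sub (integrableOn_kFibM _ _ m j a x' b y' 0)
  · rw [if_neg h, if_neg h, sub_zero, abs_zero]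
    exact mul_nonneg (c_nonneg_of_realRateKM hB) (pow_nonneg hθ0 j)

/-- [folklore] The same in `dist` form. -/
theorem dist_KTot_succ_le (hθ0 : 0 ≤ θ) (hB : RealRateKM d Lc m c θ) (x' y' : Fin (d + 1) → ℤ) (a b : Fib d) (j : ℕ) :
    dist (unitK (sfStep Lc j) (smStep d Lc j) (KTot (d := d) (Lc ^ (j + m)) (Lc ^ j)) x' y' a b)
      (unitK (sfStep Lc (j + 1)) (smStep d Lc (j + 1)) (KTot (d := d) (Lc ^ (j + 1 + m)) (Lc ^ (j + 1))) x' y' a b) ≤ c * θ ^ j := by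
  rw [dist_comm, Real.dist_eq]
  exact abs_KTot_succ_sub_le hθ0 hB j x' y' a b

/-- **X1m-K FROM THE FIBRE RATE** (general `d`, `Lc ≥ 1`, every `m`): `RealRateKM d Lc m c θ` with `0 ≤ θ < 1` ⟹ every entry of the unit-rescaled (j, m)-family
converges — LITERALLY the hypothesis `hconv` of `FP.PerfectRebase.KPerf_eq_KPerf_pow_base_of_exists_tendsto` ∕ `FP.StationarityK` ∕ `FP.SymmetryK`. [our object] -/
theorem exists_tendsto_KTot_of_realRateKM (hθ0 : 0 ≤ θ) (hθ1 : θ < 1) (hB : RealRateKM d Lc m c θ) :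
    ∀ (x y : Fin (d + 1) → ℤ) (a b : Fib d), ∃ L : ℝ,
      Tendsto (fun j => unitK (sfStep Lc j) (smStep d Lc j) (KTot (d := d) (Lc ^ (j + m)) (Lc ^ j)) x y a b) atTop (𝓝 L) :=
  fun x y a b => cauchySeq_tendsto_of_complete (cauchySeq_of_le_geometric θ c hθ1 (dist_KTot_succ_le hθ0 hB x y a b))

/-- [our object] … and the limit is the corresponding entry of the perfect `m`-fold resolvent. -/
theorem tendsto_KTot_KPerf_of_realRateKM (hθ0 : 0 ≤ θ) (hθ1 : θ < 1) (hB : RealRateKM d Lc m c θ) (x' y' : Fin (d + 1) → ℤ) (a b : Fib d) :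
    Tendsto (fun j => unitK (sfStep Lc j) (smStep d Lc j) (KTot (d := d) (Lc ^ (j + m)) (Lc ^ j)) x' y' a b) atTop
      (𝓝 (KPerf (d := d) Lc (sfStep Lc) (smStep d Lc) m x' y' a b)) := by
  obtain ⟨L, hL⟩ := exists_tendsto_KTot_of_realRateKM hθ0 hθ1 hB x' y' a b
  have hlim : KPerf (d := d) Lc (sfStep Lc) (smStep d Lc) m x' y' a b = L := by
    show limMKerOf _ x' y' a b = L
    rw [limMKerOf_apply]
    exact hL.limUnder_eq
  rw [hlim]
  exact hL

/-- **THE SUP-NORM RATE TO THE PERFECT `m`-FOLD RESOLVENT** under the shape: `|unitK_j (KTot (Lc^(j+m)) (Lc^j)) x′ y′ a b − KPerf … m x′ y′ a b| ≤ c·θ^j/(1−θ)`. [our object] -/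
theorem abs_KTot_sub_KPerf_le (hθ0 : 0 ≤ θ) (hθ1 : θ < 1) (hB : RealRateKM d Lc m c θ) (j : ℕ) (x' y' : Fin (d + 1) → ℤ) (a b : Fib d) :
    |unitK (sfStep Lc j) (smStep d Lc j) (KTot (d := d) (Lc ^ (j + m)) (Lc ^ j)) x' y' a b - KPerf (d := d) Lc (sfStep Lc) (smStep d Lc) m x' y' a b| ≤
      c * θ ^ j / (1 - θ) := by
  rw [← Real.dist_eq]
  exact dist_le_of_le_geometric_of_tendsto θ c hθ1 (dist_KTot_succ_le hθ0 hB x' y' a b) (tendsto_KTot_KPerf_of_realRateKM hθ0 hθ1 hB x' y' a b) j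

end Rate

/-! ## §4 Under the shape: the limit multiplier and the perfect `m`-fold resolvent as its lattice kernel -/

section Limit

variable {d : ℕ} {Lc : ℕ} [NeZero Lc] {m : ℕ} {c θ : ℝ}

/-- [our object] **THE LIMIT FIBRE FUNCTION OF THE PERFECT `m`-FOLD RESOLVENT**: `kFibMLim … m a x′ b y′ P := lim_j kFibM … m j a x′ b y′ P` (`limUnder`; THE limit on the
real zone under the shape, unspecified elsewhere and never read). -/
def kFibMLim (Lc : ℕ) [NeZero Lc] (m : ℕ) (a : Fib d) (x' : Fin (d + 1) → ℤ) (b : Fib d) (y' : Fin (d + 1) → ℤ) :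
    (Fin (d + 1) → ℂ) → ℂ :=
  fun P => limUnder atTop fun j => kFibM Lc (sfStep Lc) (smStep d Lc) m j a x' b y' P

/-- [folklore] `m = 1`: the limit multiplier IS `GAN24.PerfectStepFibre.kFibLim`. -/
theorem kFibMLim_one (a : Fib d) (x' : Fin (d + 1) → ℤ) (b : Fib d) (y' : Fin (d + 1) → ℤ) :
    kFibMLim Lc 1 a x' b y' = kFibLim Lc a x' b y' := rfl

/-- [folklore] The shape in `dist` form at a real momentum. -/
theorem dist_kFibM_succ_le (hB : RealRateKM d Lc m c θ) (a : Fib d) (x' : Fin (d + 1) → ℤ) (b : Fib d) (y' : Fin (d + 1) → ℤ)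
    {p : Fin (d + 1) → ℝ} (hp : p ∈ BZ (d + 1)) (j : ℕ) :
    dist (kFibM Lc (sfStep Lc) (smStep d Lc) m j a x' b y' (ofRealVec p))
      (kFibM Lc (sfStep Lc) (smStep d Lc) m (j + 1) a x' b y' (ofRealVec p)) ≤ c * θ ^ j := by
  rw [dist_comm, dist_eq_norm]
  exact hB j x' y' a b p hp

/-- [our object] **CONVERGENCE ON THE REAL ZONE** under the shape (`θ < 1`). -/
theorem tendsto_kFibM_kFibMLim (hθ1 : θ < 1) (hB : RealRateKM d Lc m c θ) (a : Fib d) (x' : Fin (d + 1) → ℤ) (b : Fib d)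
    (y' : Fin (d + 1) → ℤ) {p : Fin (d + 1) → ℝ} (hp : p ∈ BZ (d + 1)) :
    Tendsto (fun j => kFibM Lc (sfStep Lc) (smStep d Lc) m j a x' b y' (ofRealVec p)) atTop (𝓝 (kFibMLim Lc m a x' b y' (ofRealVec p))) :=
  (cauchySeq_of_le_geometric θ c hθ1 (dist_kFibM_succ_le hB a x' b y' hp)).tendsto_limUnder

/-- [our object] The uniform tail `‖kFibM_j(p) − kFibMLim(p)‖ ≤ c·θ^j/(1−θ)` on the real zone. -/
theorem norm_kFibM_sub_kFibMLim_le (hθ1 : θ < 1) (hB : RealRateKM d Lc m c θ) (a : Fib d) (x' : Fin (d + 1) → ℤ) (b : Fib d)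
    (y' : Fin (d + 1) → ℤ) {p : Fin (d + 1) → ℝ} (hp : p ∈ BZ (d + 1)) (j : ℕ) :
    ‖kFibM Lc (sfStep Lc) (smStep d Lc) m j a x' b y' (ofRealVec p) - kFibMLim Lc m a x' b y' (ofRealVec p)‖ ≤ c * θ ^ j / (1 - θ) := by
  rw [← dist_eq_norm]
  exact dist_le_of_le_geometric_of_tendsto θ c hθ1 (dist_kFibM_succ_le hB a x' b y' hp) (tendsto_kFibM_kFibMLim hθ1 hB a x' b y' hp) j

/-- [our object] A `j`-UNIFORM MAJORANT WITHOUT ANY STRIP BOUND: `‖kFibM_j(p)‖ ≤ ‖kFibM_0(p)‖ + 2c/(1−θ)` on the real zone (`0 ≤ θ < 1`). -/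
theorem norm_kFibM_le_majorant (hθ0 : 0 ≤ θ) (hθ1 : θ < 1) (hB : RealRateKM d Lc m c θ) (a : Fib d) (x' : Fin (d + 1) → ℤ) (b : Fib d)
    (y' : Fin (d + 1) → ℤ) {p : Fin (d + 1) → ℝ} (hp : p ∈ BZ (d + 1)) (j : ℕ) :
    ‖kFibM Lc (sfStep Lc) (smStep d Lc) m j a x' b y' (ofRealVec p)‖ ≤
      ‖kFibM Lc (sfStep Lc) (smStep d Lc) m 0 a x' b y' (ofRealVec p)‖ + 2 * c / (1 - θ) := by
  set f := fun j => kFibM Lc (sfStep Lc) (smStep d Lc) m j a x' b y' (ofRealVec p) with hf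
  have hc := c_nonneg_of_realRateKM hB
  have h0 : dist (f 0) (kFibMLim Lc m a x' b y' (ofRealVec p)) ≤ c / (1 - θ) :=
    dist_le_of_le_geometric_of_tendsto₀ θ c hθ1 (dist_kFibM_succ_le hB a x' b y' hp) (tendsto_kFibM_kFibMLim hθ1 hB a x' b y' hp)
  have hj : dist (f j) (kFibMLim Lc m a x' b y' (ofRealVec p)) ≤ c * θ ^ j / (1 - θ) :=
    dist_le_of_le_geometric_of_tendsto θ c hθ1 (dist_kFibM_succ_le hB a x' b y' hp) (tendsto_kFibM_kFibMLim hθ1 hB a x' b y' hp) j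
  have hθj : c * θ ^ j / (1 - θ) ≤ c / (1 - θ) :=
    div_le_div_of_nonneg_right (mul_le_of_le_one_right hc (pow_le_one₀ hθ0 hθ1.le)) (by linarith)
  have htri : ‖f j‖ ≤ ‖f 0‖ + dist (f 0) (kFibMLim Lc m a x' b y' (ofRealVec p)) + dist (f j) (kFibMLim Lc m a x' b y' (ofRealVec p)) := by
    have h1 : ‖f j‖ ≤ ‖f 0‖ + dist (f j) (f 0) := by
      rw [dist_eq_norm]; exact norm_le_norm_add_norm_sub' (f j) (f 0) |>.trans (by linarith [norm_sub_rev (f j) (f 0)])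
    have h2 : dist (f j) (f 0) ≤ dist (f j) (kFibMLim Lc m a x' b y' (ofRealVec p)) + dist (f 0) (kFibMLim Lc m a x' b y' (ofRealVec p)) := by
      rw [dist_comm (f 0)]; exact dist_triangle _ _ _
    linarith
  calc ‖f j‖ ≤ ‖f 0‖ + c / (1 - θ) + c / (1 - θ) := by linarith
    _ = ‖f 0‖ + 2 * c / (1 - θ) := by ring

/-- [our object] **THE LATTICE KERNELS OF THE (j, m)-FIBRE FUNCTIONS CONVERGE TO THE LATTICE KERNEL OF THE LIMIT MULTIPLIER**, every offset (dominated convergence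
on the zone; majorant `‖kFibM_0(p)‖ + 2c/(1−θ)`, integrable since `kFibM_0` is one explicit finite sum). -/
theorem tendsto_latticeKernel_kFibM (hθ0 : 0 ≤ θ) (hθ1 : θ < 1) (hB : RealRateKM d Lc m c θ) (a : Fib d) (x' : Fin (d + 1) → ℤ) (b : Fib d)
    (y' : Fin (d + 1) → ℤ) (x : Fin (d + 1) → ℤ) :
    Tendsto (fun j => latticeKernel (kFibM Lc (sfStep Lc) (smStep d Lc) m j a x' b y') x) atTop
      (𝓝 (latticeKernel (kFibMLim Lc m a x' b y') x)) := by
  unfold latticeKernel fourierBox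
  refine Tendsto.const_smul ?_ _
  refine tendsto_integral_of_dominated_convergence
    (fun p => ‖kFibM Lc (sfStep Lc) (smStep d Lc) m 0 a x' b y' (ofRealVec p)‖ + 2 * c / (1 - θ)) ?_ ?_ ?_ ?_
  · intro j
    exact (integrableOn_kFibM (Lc := Lc) (sfStep Lc) (smStep d Lc) m j a x' b y' x).aestronglyMeasurable
  · exact (integrableOn_norm_of_integrand_zero (integrableOn_kFibM (Lc := Lc) (sfStep Lc) (smStep d Lc) m 0 a x' b y' 0)).add
      (integrableOn_const (volume_BZ_lt_top d).ne)
  · intro j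
    refine ae_restrict_of_forall_mem (by unfold BZ; exact measurableSet_Icc) fun p hp => ?_
    unfold integrand
    rw [norm_mul, norm_cexp_phase, mul_one]
    exact norm_kFibM_le_majorant hθ0 hθ1 hB a x' b y' hp j
  · refine ae_restrict_of_forall_mem (by unfold BZ; exact measurableSet_Icc) fun p hp => ?_
    unfold integrand
    exact (tendsto_kFibM_kFibMLim hθ1 hB a x' b y' hp).mul_const _

/-- **THE PERFECT `m`-FOLD RESOLVENT AS THE LATTICE KERNEL OF THE LIMIT MULTIPLIER** (general `d`, `Lc ≥ 1`, every `m`, under `RealRateKM d Lc m c θ`, `0 ≤ θ < 1`):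
`KPerf Lc (sfStep Lc) (smStep d Lc) m x′ y′ a b = [LegOn (Lc^m) a x′ ∧ LegOn (Lc^m) b y′] · Re latticeKernel (kFibMLim … m a x′ b y′) 0` — leaf N0b-K of road FP for every `m`
and ALL quarters in named-limit form, reduced to the one fibre shape. [our object] -/
theorem KPerf_eq_fibre_of_realRateKM (hθ0 : 0 ≤ θ) (hθ1 : θ < 1) (hB : RealRateKM d Lc m c θ) (x' y' : Fin (d + 1) → ℤ) (a b : Fib d) :
    KPerf (d := d) Lc (sfStep Lc) (smStep d Lc) m x' y' a b =
      if LegOn (Lc ^ m) a x' ∧ LegOn (Lc ^ m) b y' then (latticeKernel (kFibMLim Lc m a x' b y') 0).re else 0 := by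
  refine tendsto_nhds_unique (tendsto_KTot_KPerf_of_realRateKM hθ0 hθ1 hB x' y' a b) ?_
  have h : (fun j => unitK (sfStep Lc j) (smStep d Lc j) (KTot (d := d) (Lc ^ (j + m)) (Lc ^ j)) x' y' a b) = fun j =>
      if LegOn (Lc ^ m) a x' ∧ LegOn (Lc ^ m) b y' then (latticeKernel (kFibM Lc (sfStep Lc) (smStep d Lc) m j a x' b y') 0).re else 0 := by
    funext j; exact unitK_KTot_eq (sfStep Lc) (smStep d Lc) m j x' y' a b
  rw [h]
  split_ifs with hc
  · exact (Complex.continuous_re.tendsto _).comp (tendsto_latticeKernel_kFibM hθ0 hθ1 hB a x' b y' 0)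
  · exact tendsto_const_nhds

/-- [our object] CONSISTENCY AT `m = 1` (`d = 3`, `2 ≤ Lc`): the general-`m` statement specialises to `GAN24.PerfectStepFibre`'s (same multiplier `kFibLim`, support `LegOn Lc`),
with road P1's (I2′) as the shape and NO strip bound used. -/
theorem KPerf_one_eq_fibre' {Lc : ℕ} [NeZero Lc] (hLc : 2 ≤ Lc) (x' y' : Fin (3 + 1) → ℤ) (a b : Fib 3) :
    KPerf (d := 3) Lc (sfStep Lc) (smStep 3 Lc) 1 x' y' a b =
      if LegOn (Lc ^ 1) a x' ∧ LegOn (Lc ^ 1) b y' then (latticeKernel (kFibLim Lc a x' b y') 0).re else 0 :=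
  KPerf_eq_fibre_of_realRateKM (theta_nonneg_lt_one hLc).1 (theta_nonneg_lt_one hLc).2 (realRateKM_one_holds hLc) x' y' a b

end Limit

end

end Summit.QuantumFields.BalabanUV.Beta.GAN24.PerfectResolventFibre
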